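import Summits.QuantumFields.BalabanUV.T4Continuum.Support.NE7FlatGradientLetterLogCurl
import HarnessLib

/-!
# NE7FlatGradientLetterLogCurlClosed — THE FLAT C¹ COMPACT LETTER, PART (iv), CLOSED FORM: `‖Z(x+e_μ,κ) − Z(x,κ)‖ ≤ C(d)·(B·(1 + log⁺((R+1)·B′∕B)) + (R+1)·D′ + (1 + log(R+1))·Gb)`
# — the form of [NE7P1-G107-INBOX-2], from the free-radius letter `NE7FlatGradientLetterLogCurl.gradient_letter_cube_logCurl_radius` with the cut radius `ρ := ⌊B∕B″⌋ + 2`,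
# `B″ := min(max(B′, B∕(2R+3)), 2B)` (the curl's adjacent differences are `≤ B″` too; `ρ·B″ ≤ 5B`, `log⁺((2R+3)∕ρ) ≤ 2 + log⁺((R+1)B′∕B)`)

Cell `pub-balaban`, rung (B)+1 sub-cell t4; written by the row-NE7b OWNER lineage `b2b-balaban-t4-ne7b-p1` (gen 154) for the sibling crux row NE7 (lineage `t4-ne7-p1`,
gen 107's INTERFACE REQUEST NE7→NE7b stub (S-c) PART (iv), `HOME/INBOX.md` [NE7P1-G107-INBOX-2]).  Sequel of `NE7FlatGradientLetterLogCurl` (§1, free radius).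
WHAT ([folklore]; 0 def, 0 sorry; every `d ≥ 3`).  `posLog_max_one`, `posLog_three_mul_le`, **`gradient_letter_cube_logCurl`** (hypotheses: `Z` vanishing off `cube c R`; `0 < B` with
`‖curlAt 1 Z z μ ν‖ ≤ B` (`μ ≠ ν`); `0 ≤ B′` with `‖curlAt 1 Z (z+e_λ) μ ν − curlAt 1 Z z μ ν‖ ≤ B′` (`μ ≠ ν`); `flatDiv Z = g + s`, `g` vanishing off `cube c (R+1)`, `‖g‖ ≤ Gb`,
`‖s(x+e_λ) − s x‖ ≤ D′`).
HONEST FRAMING (page 1): real arithmetic over §1; `U = 1`, flat; NOT the curved letter, NOT the bootstrap, NOT NE7, nothing of row NE7b (`T4WeightBudget.RelWeightBound` NOT PRINTED ∕ NOT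
PROVED); nothing of Bałaban's asserted; spine count = dagwriter∕referees' call; finite T⁴ rung (B)+1 — NOT infinite volume, NOT mass gap, NOT BetaPertH, NOT Clay.  Continuum YM on T⁴ ⇐
BetaPertH ∧ nine spine estimates (0/9 proved); BetaPertH ⇐ (D1) ∧ (D4) ∧ CAP+tail; G-an2-4 gates asym, D1 and NE2/3/4.
-/

set_option autoImplicit false

open scoped BigOperators Matrix.Norms.L2Operator
open Finset

namespace Summit.QuantumFields.BalabanUV.T4Continuum.NE7FlatGradientLetterLogCurlClosed

open Literature.MathematicalPhysics.QuantumFieldTheory.Balaban1983to89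
open B7Prop1Explicit (Site e)
open T4AveragingDeficitWall (curlAt)
open BlockAveragePushDirSplit (flat)
open NE3CoercivityScaling (flatDiv)
open Beta.PoissonInterior (cube)
open NE7FlatGradientLetterLogCurl (gradient_letter_cube_logCurl_radius)

noncomputable section

variable {d : ℕ} {n : Type*} [Fintype n] [DecidableEq n]

/-! ## The requested form: the cut radius chosen from `B∕B′` -/

omit [Fintype n] [DecidableEq n] in
/-- `log⁺(max(t, 1)) = log⁺ t` for `t ≥ 0`. [folklore] -/
theorem posLog_max_one {t : ℝ} (ht : 0 ≤ t) : Real.posLog (max t 1) = Real.posLog t := by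
  rcases le_or_gt t 1 with h | h
  · rw [max_eq_right h, Real.posLog_one, (Real.posLog_eq_zero_iff t).2 (by rw [abs_of_nonneg ht]; exact h)]
  · rw [max_eq_left h.le]

omit [Fintype n] [DecidableEq n] in
/-- `log⁺(3t) ≤ 2 + log⁺ t` for `t ≥ 0`. [folklore] -/
theorem posLog_three_mul_le {t : ℝ} (ht : 0 ≤ t) : Real.posLog (3 * t) ≤ 2 + Real.posLog t := by
  have h1 : Real.posLog (3 * t) ≤ Real.posLog 3 + Real.posLog t := Real.posLog_mul
  have h2 : Real.posLog (3 : ℝ) ≤ 2 := by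
    rw [Real.posLog_eq_log (by rw [abs_of_pos (by norm_num)]; norm_num)]
    have := Real.log_le_sub_one_of_pos (show (0 : ℝ) < 3 by norm_num)
    linarith
  have _ := ht
  linarith

/-- **THE FLAT C¹ COMPACT LETTER WITH THE LOG-INTERPOLATED CURL DATUM** (`d ≥ 3`; the form of [NE7P1-G107-INBOX-2]): `∃ C ≥ 0` (a function of `d`) such that for every cube
`cube c R`, every bond field `Z` vanishing off it, every `B > 0` with `‖curlAt 1 Z z μ ν‖ ≤ B` (`μ ≠ ν`), every `B′ ≥ 0` bounding the curl's adjacent differences (`μ ≠ ν`), every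
splitting `flatDiv Z = g + s` with `g` vanishing off `cube c (R+1)`, `‖g‖ ≤ Gb`, `‖s(x+e_λ) − s x‖ ≤ D′`:
`‖Z (x+e_μ) κ − Z x κ‖ ≤ C·(B·(1 + log⁺((R+1)·B′∕B)) + (R+1)·D′ + (1 + log(R+1))·Gb)`. [folklore] -/
theorem gradient_letter_cube_logCurl (hd : 3 ≤ d) : ∃ C : ℝ, 0 ≤ C ∧
    ∀ (c : Site d) (R : ℕ) (Z : Site d → Fin d → Matrix n n ℂ), (∀ x, x ∉ cube c R → Z x = 0) →
      ∀ (B : ℝ), 0 < B → (∀ (z : Site d) (μ ν : Fin d), μ ≠ ν → ‖curlAt (flat (d := d) (n := n)) Z z μ ν‖ ≤ B) →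
      ∀ (B' : ℝ), 0 ≤ B' → (∀ (z : Site d) (lam μ ν : Fin d), μ ≠ ν →
        ‖curlAt (flat (d := d) (n := n)) Z (z + e lam) μ ν - curlAt (flat (d := d) (n := n)) Z z μ ν‖ ≤ B') →
      ∀ (g s : Site d → Matrix n n ℂ), (∀ x, flatDiv Z x = g x + s x) → (∀ x, x ∉ cube c (R + 1) → g x = 0) →
      ∀ (Gb : ℝ), (∀ x, ‖g x‖ ≤ Gb) → ∀ (D' : ℝ), (∀ (x : Site d) (lam : Fin d), ‖s (x + e lam) - s x‖ ≤ D') →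
      ∀ (x : Site d) (μ κ : Fin d),
        ‖Z (x + e μ) κ - Z x κ‖ ≤ C * (B * (1 + Real.posLog (((R : ℝ) + 1) * B' / B))
          + ((R : ℝ) + 1) * D' + (1 + Real.log ((R : ℝ) + 1)) * Gb) := by
  obtain ⟨C, hC, h⟩ := gradient_letter_cube_logCurl_radius (d := d) (n := n) hd
  refine ⟨8 * C, by positivity, fun c R Z hZ B hBpos hBc B' hB0 hB g s hgs hg0 Gb hg D' hs x μ κ => ?_⟩
  have hG00 : 0 ≤ Gb := (norm_nonneg _).trans (hg x)
  have hD0 : 0 ≤ D' := (norm_nonneg _).trans (hs x μ)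
  have hR0 : (0 : ℝ) ≤ R := by positivity
  have hR3 : (0 : ℝ) < 2 * R + 3 := by positivity
  have hlog0 : 0 ≤ Real.log ((R : ℝ) + 1) := Real.log_nonneg (by linarith)
  -- the effective Lipschitz constant `B″ = min(max(B′, B/(2R+3)), 2B)`
  set q : ℝ := B / (2 * R + 3) with hq
  have hq0 : 0 < q := by positivity
  set B'' : ℝ := min (max B' q) (2 * B) with hB''
  have hB''pos : 0 < B'' := lt_min (lt_of_lt_of_le hq0 (le_max_right _ _)) (by linarith)
  have hB''le2 : B'' ≤ 2 * B := min_le_right _ _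
  have hB''lemax : B'' ≤ max B' q := min_le_left _ _
  have hB'' : ∀ (z : Site d) (lam μ' ν' : Fin d), μ' ≠ ν' →
      ‖curlAt (flat (d := d) (n := n)) Z (z + e lam) μ' ν' - curlAt (flat (d := d) (n := n)) Z z μ' ν'‖ ≤ B'' := by
    intro z lam μ' ν' hne
    refine le_min ((hB z lam μ' ν' hne).trans (le_max_left _ _)) ?_
    calc _ ≤ ‖curlAt (flat (d := d) (n := n)) Z (z + e lam) μ' ν'‖ + ‖curlAt (flat (d := d) (n := n)) Z z μ' ν'‖ := norm_sub_le _ _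
      _ ≤ B + B := add_le_add (hBc _ _ _ hne) (hBc _ _ _ hne)
      _ = 2 * B := by ring
  -- the radius
  set ρ : ℕ := ⌊B / B''⌋₊ + 2 with hρ
  have hρ2 : 2 ≤ ρ := by omega
  have ht0 : 0 ≤ B / B'' := by positivity
  have hρge : B / B'' ≤ (ρ : ℝ) := by
    have := Nat.lt_floor_add_one (B / B'')
    rw [hρ]; push_cast; linarith
  have hρle : (ρ : ℝ) ≤ B / B'' + 2 := by
    have := Nat.floor_le ht0
    rw [hρ]; push_cast; linarith
  have hρpos : (0 : ℝ) < ρ := by exact_mod_cast (by omega : 0 < ρ)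
  have hmain := h c R Z hZ B hBc B'' hB''pos.le hB'' g s hgs hg0 Gb hg D' hs ρ hρ2 x μ κ
  -- `ρ B″ ≤ 5 B`
  have hρB : (ρ : ℝ) * B'' ≤ 5 * B := by
    calc (ρ : ℝ) * B'' ≤ (B / B'' + 2) * B'' := mul_le_mul_of_nonneg_right hρle hB''pos.le
      _ = B + 2 * B'' := by field_simp
      _ ≤ 5 * B := by linarith
  -- `log⁺((2R+3)/ρ) ≤ 2 + log⁺((R+1)B′/B)`
  have hfrac : ((2 * R + 3 : ℕ) : ℝ) / ρ ≤ (2 * R + 3) * B'' / B := by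
    have hc : ((2 * R + 3 : ℕ) : ℝ) = 2 * R + 3 := by push_cast; ring
    rw [hc, div_le_div_iff₀ hρpos hBpos]
    calc (2 * (R : ℝ) + 3) * B = (2 * R + 3) * (B / B'' * B'') := by field_simp
      _ ≤ (2 * R + 3) * (ρ * B'') := by
          apply mul_le_mul_of_nonneg_left _ hR3.le
          exact mul_le_mul_of_nonneg_right hρge hB''pos.le
      _ = (2 * R + 3) * B'' * ρ := by ring
  have hmaxle : (2 * (R : ℝ) + 3) * B'' / B ≤ max (3 * (((R : ℝ) + 1) * B' / B)) 1 := by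
    rw [div_le_iff₀ hBpos]
    rcases le_total B' q with hle | hle
    · -- `max B′ q = q`, so `(2R+3) B″ ≤ (2R+3) q = B`
      have hm : max B' q = q := max_eq_right hle
      calc (2 * (R : ℝ) + 3) * B'' ≤ (2 * R + 3) * q := mul_le_mul_of_nonneg_left (hB''lemax.trans (le_of_eq hm)) hR3.le
        _ = B := by rw [hq]; field_simp
        _ = 1 * B := (one_mul B).symm
        _ ≤ max (3 * (((R : ℝ) + 1) * B' / B)) 1 * B := mul_le_mul_of_nonneg_right (le_max_right _ _) hBpos.le
    · have hm : max B' q = B' := max_eq_left hle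
      calc (2 * (R : ℝ) + 3) * B'' ≤ (2 * R + 3) * B' := mul_le_mul_of_nonneg_left (hB''lemax.trans (le_of_eq hm)) hR3.le
        _ ≤ 3 * ((R : ℝ) + 1) * B' := mul_le_mul_of_nonneg_right (by linarith) hB0
        _ = 3 * (((R : ℝ) + 1) * B' / B) * B := by field_simp
        _ ≤ max (3 * (((R : ℝ) + 1) * B' / B)) 1 * B := mul_le_mul_of_nonneg_right (le_max_left _ _) hBpos.le
  have ht1 : 0 ≤ ((R : ℝ) + 1) * B' / B := by positivity
  have hPle : Real.posLog (((2 * R + 3 : ℕ) : ℝ) / ρ) ≤ 2 + Real.posLog (((R : ℝ) + 1) * B' / B) := by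
    calc Real.posLog (((2 * R + 3 : ℕ) : ℝ) / ρ) ≤ Real.posLog (max (3 * (((R : ℝ) + 1) * B' / B)) 1) :=
          Real.posLog_le_posLog (by positivity) (hfrac.trans hmaxle)
      _ = Real.posLog (3 * (((R : ℝ) + 1) * B' / B)) := posLog_max_one (by positivity)
      _ ≤ 2 + Real.posLog (((R : ℝ) + 1) * B' / B) := posLog_three_mul_le ht1
  have hP0 : 0 ≤ Real.posLog (((R : ℝ) + 1) * B' / B) := Real.posLog_nonneg
  calc ‖Z (x + e μ) κ - Z x κ‖
      ≤ C * (ρ * B'' + (1 + Real.posLog (((2 * R + 3 : ℕ) : ℝ) / ρ)) * B + ((R : ℝ) + 1) * D' + (1 + Real.log ((R : ℝ) + 1)) * Gb) := hmain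
    _ ≤ C * (5 * B + (3 + Real.posLog (((R : ℝ) + 1) * B' / B)) * B + ((R : ℝ) + 1) * D' + (1 + Real.log ((R : ℝ) + 1)) * Gb) := by
        apply mul_le_mul_of_nonneg_left _ hC
        have : (1 + Real.posLog (((2 * R + 3 : ℕ) : ℝ) / ρ)) * B ≤ (3 + Real.posLog (((R : ℝ) + 1) * B' / B)) * B :=
          mul_le_mul_of_nonneg_right (by linarith) hBpos.le
        linarith
    _ ≤ 8 * C * (B * (1 + Real.posLog (((R : ℝ) + 1) * B' / B)) + ((R : ℝ) + 1) * D' + (1 + Real.log ((R : ℝ) + 1)) * Gb) := by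
        have hX3 : 0 ≤ ((R : ℝ) + 1) * D' := by positivity
        have hX4 : 0 ≤ (1 + Real.log ((R : ℝ) + 1)) * Gb := by positivity
        nlinarith only [hC, hBpos.le, hP0, hX3, hX4, mul_nonneg hC hX3, mul_nonneg hC hX4, mul_nonneg hC (mul_nonneg hBpos.le hP0), mul_nonneg hC hBpos.le]



/-! ## The same letter in the block-aligned-box geometry -/

omit [Fintype n] [DecidableEq n] in
/-- `log⁺(2t) ≤ 1 + log⁺ t` for `t ≥ 0`. [folklore] -/
theorem posLog_two_mul_le {t : ℝ} (ht : 0 ≤ t) : Real.posLog (2 * t) ≤ 1 + Real.posLog t := by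
  have h1 : Real.posLog (2 * t) ≤ Real.posLog 2 + Real.posLog t := Real.posLog_mul
  have h2 : Real.posLog (2 : ℝ) ≤ 1 := by
    rw [Real.posLog_eq_log (by rw [abs_of_pos (by norm_num)]; norm_num)]
    have := Real.log_le_sub_one_of_pos (show (0 : ℝ) < 2 by norm_num)
    linarith
  have _ := ht
  linarith

/-- **THE FLAT C¹ COMPACT LETTER WITH THE LOG-INTERPOLATED CURL DATUM, BOX GEOMETRY** (dimension `d + 1 ≥ 3`, every `L ≥ 1`, every `k`; `M = L^{k+1}`, `P = M·N′`): `∃ K ≥ 0`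
(a function of `d`) such that for every block-aligned box `M•c′ + [0, P)^{d+1}` (`N′ ≥ 1`), every bond field `Z` vanishing off the box, every `B > 0` with `‖curlAt 1 Z z μ ν‖ ≤ B`
(`μ ≠ ν`), every `B′ ≥ 0` bounding the curl's adjacent differences (`μ ≠ ν`), every splitting `flatDiv Z = g + s` with `g` vanishing off the one-site enlargement of the box
(`M c′_i − 1 ≤ x_i ≤ M c′_i + P`), `‖g‖ ≤ Gb`, `‖s(x+e_λ) − s x‖ ≤ D′`:
`‖Z (x+e_μ) κ − Z x κ‖ ≤ K·(B·(1 + log⁺(P·B′∕B)) + P·D′ + (1 + log P)·Gb)`. [folklore] -/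
theorem gradient_letter_box_logCurl (hd : 2 ≤ d) :
    ∃ K : ℝ, 0 ≤ K ∧ ∀ (L : ℕ), 1 ≤ L → ∀ (k : ℕ) (c' : Site (d + 1)) (N' : ℕ), 1 ≤ N' →
      ∀ (Z : Site (d + 1) → Fin (d + 1) → Matrix n n ℂ),
      (∀ x : Site (d + 1), (∃ i, ¬ (((L ^ (k + 1) : ℕ) : ℤ) * c' i ≤ x i ∧
          x i < ((L ^ (k + 1) : ℕ) : ℤ) * c' i + ((L ^ (k + 1) : ℕ) : ℤ) * N')) → Z x = 0) →
      ∀ (B : ℝ), 0 < B → (∀ (z : Site (d + 1)) (μ ν : Fin (d + 1)), μ ≠ ν → ‖curlAt (flat (d := d + 1) (n := n)) Z z μ ν‖ ≤ B) →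
      ∀ (B' : ℝ), 0 ≤ B' → (∀ (z : Site (d + 1)) (lam μ ν : Fin (d + 1)), μ ≠ ν →
        ‖curlAt (flat (d := d + 1) (n := n)) Z (z + e lam) μ ν - curlAt (flat (d := d + 1) (n := n)) Z z μ ν‖ ≤ B') →
      ∀ (g s : Site (d + 1) → Matrix n n ℂ), (∀ x, flatDiv Z x = g x + s x) →
      (∀ x : Site (d + 1), (∃ i, ¬ (((L ^ (k + 1) : ℕ) : ℤ) * c' i - 1 ≤ x i ∧
          x i ≤ ((L ^ (k + 1) : ℕ) : ℤ) * c' i + ((L ^ (k + 1) : ℕ) : ℤ) * N')) → g x = 0) →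
      ∀ (Gb : ℝ), (∀ x, ‖g x‖ ≤ Gb) → ∀ (D' : ℝ), (∀ (x : Site (d + 1)) (lam : Fin (d + 1)), ‖s (x + e lam) - s x‖ ≤ D') →
      ∀ (x : Site (d + 1)) (μ κ : Fin (d + 1)),
        ‖Z (x + e μ) κ - Z x κ‖ ≤ K * (B * (1 + Real.posLog (((L : ℝ) ^ (k + 1) * N') * B' / B))
          + ((L : ℝ) ^ (k + 1) * N') * D' + (1 + Real.log ((L : ℝ) ^ (k + 1) * N')) * Gb) := by
  obtain ⟨C, hC, h⟩ := gradient_letter_cube_logCurl (d := d + 1) (n := n) (by omega)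
  refine ⟨2 * C, by positivity, fun L hL k c' N' hN' Z hZ B hBpos hBc B' hB0 hB g s hgs hg0 Gb hg D' hs x μ κ => ?_⟩
  have hD0 : 0 ≤ D' := (norm_nonneg _).trans (hs x μ)
  have hG00 : 0 ≤ Gb := (norm_nonneg _).trans (hg x)
  have hZ' : ∀ y, y ∉ cube (fun i => ((L ^ (k + 1) : ℕ) : ℤ) * c' i) (L ^ (k + 1) * N') → Z y = 0 := by
    intro y hy
    refine hZ y ?_
    by_contra hall
    simp only [not_exists, not_not] at hall
    apply hy
    rw [Beta.PoissonInterior.mem_cube]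
    intro i
    obtain ⟨h1, h2⟩ := hall i
    have hN0 : (0 : ℤ) ≤ ((L ^ (k + 1) : ℕ) : ℤ) * N' := by positivity
    rw [abs_le]
    constructor <;> push_cast at h1 h2 hN0 ⊢ <;> linarith
  have hg0' : ∀ y, y ∉ cube (fun i => ((L ^ (k + 1) : ℕ) : ℤ) * c' i) (L ^ (k + 1) * N' + 1) → g y = 0 := by
    intro y hy
    refine hg0 y ?_
    by_contra hall
    simp only [not_exists, not_not] at hall
    apply hy
    rw [Beta.PoissonInterior.mem_cube]
    intro i
    obtain ⟨h1, h2⟩ := hall i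
    have hN0 : (0 : ℤ) ≤ ((L ^ (k + 1) : ℕ) : ℤ) * N' := by positivity
    rw [abs_le]
    constructor <;> push_cast at h1 h2 hN0 ⊢ <;> linarith
  have hM1 : 1 ≤ L ^ (k + 1) * N' := Nat.one_le_iff_ne_zero.mpr (Nat.mul_ne_zero (pow_ne_zero _ (by omega)) (by omega))
  have hR1 : (1 : ℝ) ≤ ((L ^ (k + 1) * N' : ℕ) : ℝ) := by exact_mod_cast hM1
  have hRr : ((L ^ (k + 1) * N' : ℕ) : ℝ) = (L : ℝ) ^ (k + 1) * N' := by push_cast; ring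
  have hmain := h _ _ Z hZ' B hBpos hBc B' hB0 hB g s hgs hg0' Gb hg D' hs x μ κ
  set P : ℝ := (L : ℝ) ^ (k + 1) * N' with hP
  have hP1 : 1 ≤ P := by rw [← hRr]; exact hR1
  have hRP : ((L ^ (k + 1) * N' : ℕ) : ℝ) + 1 ≤ 2 * P := by rw [hRr]; linarith
  have ht0 : 0 ≤ P * B' / B := by positivity
  -- the three slots
  have hlogt : Real.posLog ((((L ^ (k + 1) * N' : ℕ) : ℝ) + 1) * B' / B) ≤ 1 + Real.posLog (P * B' / B) := by
    calc Real.posLog ((((L ^ (k + 1) * N' : ℕ) : ℝ) + 1) * B' / B) ≤ Real.posLog (2 * (P * B' / B)) := by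
          apply Real.posLog_le_posLog (by positivity)
          rw [mul_div_assoc, mul_div_assoc, ← mul_assoc]
          exact mul_le_mul_of_nonneg_right hRP (by positivity)
      _ ≤ 1 + Real.posLog (P * B' / B) := posLog_two_mul_le ht0
  have hlogP : Real.log ((((L ^ (k + 1) * N' : ℕ) : ℝ)) + 1) ≤ 1 + Real.log P := by
    calc Real.log ((((L ^ (k + 1) * N' : ℕ) : ℝ)) + 1) ≤ Real.log (2 * P) := Real.log_le_log (by positivity) hRP
      _ = Real.log 2 + Real.log P := Real.log_mul (by norm_num) (by positivity)
      _ ≤ 1 + Real.log P := by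
          have := Real.log_le_sub_one_of_pos (show (0 : ℝ) < 2 by norm_num); linarith
  have hlogP0 : 0 ≤ Real.log P := Real.log_nonneg hP1
  have hPl0 : 0 ≤ Real.posLog (P * B' / B) := Real.posLog_nonneg
  calc ‖Z (x + e μ) κ - Z x κ‖
      ≤ C * (B * (1 + Real.posLog ((((L ^ (k + 1) * N' : ℕ) : ℝ) + 1) * B' / B)) + (((L ^ (k + 1) * N' : ℕ) : ℝ) + 1) * D'
          + (1 + Real.log (((L ^ (k + 1) * N' : ℕ) : ℝ) + 1)) * Gb) := hmain
    _ ≤ C * (B * (2 * (1 + Real.posLog (P * B' / B))) + (2 * P) * D' + (2 * (1 + Real.log P)) * Gb) := by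
        apply mul_le_mul_of_nonneg_left _ hC
        apply add_le_add
        · apply add_le_add
          · exact mul_le_mul_of_nonneg_left (by linarith) hBpos.le
          · exact mul_le_mul_of_nonneg_right hRP hD0
        · exact mul_le_mul_of_nonneg_right (by linarith) hG00
    _ = 2 * C * (B * (1 + Real.posLog (P * B' / B)) + P * D' + (1 + Real.log P) * Gb) := by ring

end

end Summit.QuantumFields.BalabanUV.T4Continuum.NE7FlatGradientLetterLogCurlClosed
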